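import Mathlib
import HarnessLib
import Summits.Ventures.LatticeQCDFlow.Exactness.SU3SpectralCouplingLayerBooked

/-!
# The `SU(3)` spectral kernel in the engine's box coordinate: box flow `χ` on `(0,1)²` → stick-breaking `φ` → affine `ζ` → alcove; exact with exactly the booked density `Jχ(a)·(1−(χa)₀)/(1−a₀) · |Δ(e^{ix'})|²/|Δ(e^{ix})|²`

HONEST FRAMING: exact (Metropolis-corrected) sampling algorithms for lattice gauge theory;
figures of merit are autocorrelation/cost numbers at stated couplings and volumes; no
continuum-physics claim.

Venture `LatticeQCDFlow` (cell pub-lqcd), topic `Exactness`; FANOUT row 10 (`eng-equiv`, engine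
`latflow.equiv` `spectral.spectral_kernel`, `N = 3`, `cell = 'simplex'`: `x → ρ = ζ⁻¹(x) → a = φ⁻¹(ρ)
→ a' = χ(a) → ρ' = φ(a') → x' = ζ(ρ')`, `ldj = ld_chi + ld_phi_out − ld_phi_in + log_haar(x') −
log_haar(x)` with `ld_phi = log(1 − a₀)`; Boyda et al., PRD 103 (2021) 074504 §III.C eqs. (21)–(24),
App. B Algorithm 2).  NEW WORK of the cell: the capstone of the `N = 3` series — the hypotheses of
`hasJacobian_spectralKernel_su3_booked` are produced from the BOX FLOW: the alcove map
`G = ζ ∘ φ ∘ χ ∘ φ⁻¹ ∘ ζ⁻¹` and its Jacobian `JA` are constructed here, `G(A) ⊆ A` from `χ(B) ⊆ B`.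
Nothing is cited as a fact; no number; no definition (`φ`, `ζ` through characterising hypotheses).

## What is typed (`B = (0,1)²`, `Δ° = {0 < ρ₀, 0 < ρ₁, ρ₀ + ρ₁ < 1}`, `A = {θ₀ < θ₁ < −θ₀−θ₁ < θ₀ + 2π}`,
`φ(a) = (a₀, a₁(1 − a₀))`, `ζ(ρ) = (−4π/3 + (2π/3)ρ₀ + (4π/3)ρ₁, 2π/3 − (4π/3)ρ₀ − (2π/3)ρ₁)`)

* `alcoveAffine_leftInverse_su3` / `…_rightInverse_su3`, `stickBreaking_leftInverse_two` /
  `…_rightInverse_two`, `stickBreakingInv_mem_box_two`, `alcoveAffineInv_mem_simplex_su3`,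
  `alcoveAffine_stickBreaking_mem_alcove_su3` — the two charts are bijections `B → Δ° → A` with the
  explicit inverses `φ⁻¹(ρ) = (ρ₀, ρ₁/(1 − ρ₀))`, `ζ⁻¹(θ) = (−(θ₀ + 2θ₁)/2π, (2θ₀ + θ₁)/2π + 1)`;
* **`hasJacobian_spectralKernel_su3_booked_boxFlow`** — `χ` a box flow with
  `HasJacobian (Leb|_B) χ Jχ` and `χ(B) ⊆ B` (e.g. the autoregressive box flow of
  `BoxCouplingFlowJacobian.lean`); `f` measurable (no continuity), permutation-equivariant,
  with `f(e^{i x(ζφa)}) = e^{i x(ζφ(χ a))}` for `a ∈ B`; ANY kernel `h` following the spectral recipe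
  of `f`; ANY `J` (measurability is automatic, `measurable_of_spectral`) which is a symmetric measurable function `JD` of the
  spectrum with, for `a ∈ B`,
  `JD(e^{ix(ζφa)})·|Δ(e^{ix(ζφa)})|²/3! = (|1−(χa)₀|·Jχ(a)/|1−a₀|)·|Δ(e^{ix(ζφ(χa))})|²/3!` — the
  density `exp(ldj)` booked by `spectral_kernel`.  Then `HasJacobian (Haar SU(3)) h J`.

NOT here: the elimination of the measurability of `J`; `N ≥ 4`; any number.
-/

noncomputable section

namespace Summit.Ventures.LatticeQCDFlow.Exactness

open MeasureTheory Matrix Set Real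
open Literature.LinearAlgebra.Matrix
open Literature.MathematicalPhysics.QuantumFieldTheory (haarProbability)
open scoped ENNReal

/-! ## The two charts and their inverses -/

section Charts

variable {φ ζ : (Fin 2 → ℝ) → (Fin 2 → ℝ)}
  (hφ : ∀ a, φ a = ![a 0, a 1 * (1 - a 0)])
  (hζ : ∀ r, ζ r = ![-(4 * π / 3) + 2 * π / 3 * r 0 + 4 * π / 3 * r 1, 2 * π / 3 - 4 * π / 3 * r 0 - 2 * π / 3 * r 1])

include hζ in
/-- `ζ⁻¹ ∘ ζ = id` with `ζ⁻¹(θ) = (−(θ₀ + 2θ₁)/2π, (2θ₀ + θ₁)/2π + 1)`. -/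
theorem alcoveAffine_leftInverse_su3 (r : Fin 2 → ℝ) :
    (![-((ζ r) 0 + 2 * (ζ r) 1) / (2 * π), (2 * (ζ r) 0 + (ζ r) 1) / (2 * π) + 1] : Fin 2 → ℝ) = r := by
  have hπ : π ≠ 0 := pi_ne_zero
  funext i
  fin_cases i
  · simp only [hζ, Matrix.cons_val_zero, Matrix.cons_val_one, Fin.zero_eta]
    field_simp
    ring
  · simp only [hζ, Matrix.cons_val_zero, Matrix.cons_val_one, Fin.mk_one]
    field_simp
    ring

include hζ in
/-- `ζ ∘ ζ⁻¹ = id`. -/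
theorem alcoveAffine_rightInverse_su3 (θ : Fin 2 → ℝ) :
    ζ (![-(θ 0 + 2 * θ 1) / (2 * π), (2 * θ 0 + θ 1) / (2 * π) + 1]) = θ := by
  have hπ : π ≠ 0 := pi_ne_zero
  rw [hζ]
  funext i
  fin_cases i
  · simp only [Matrix.cons_val_zero, Matrix.cons_val_one, Fin.zero_eta]
    field_simp
    ring
  · simp only [Matrix.cons_val_zero, Matrix.cons_val_one, Fin.mk_one]
    field_simp
    ring

include hφ in
/-- `φ⁻¹ ∘ φ = id` off `a₀ = 1`, with `φ⁻¹(ρ) = (ρ₀, ρ₁/(1 − ρ₀))`. -/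
theorem stickBreaking_leftInverse_two {a : Fin 2 → ℝ} (ha : a 0 ≠ 1) :
    (![(φ a) 0, (φ a) 1 / (1 - (φ a) 0)] : Fin 2 → ℝ) = a := by
  have h1 : 1 - a 0 ≠ 0 := sub_ne_zero.mpr (Ne.symm ha)
  funext i
  fin_cases i
  · simp [hφ]
  · simp only [hφ, Matrix.cons_val_zero, Matrix.cons_val_one, Fin.mk_one]
    field_simp

include hφ in
/-- `φ ∘ φ⁻¹ = id` off `ρ₀ = 1`. -/
theorem stickBreaking_rightInverse_two {ρ : Fin 2 → ℝ} (hρ : ρ 0 ≠ 1) :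
    φ (![ρ 0, ρ 1 / (1 - ρ 0)]) = ρ := by
  have h1 : 1 - ρ 0 ≠ 0 := sub_ne_zero.mpr (Ne.symm hρ)
  rw [hφ]
  funext i
  fin_cases i
  · simp
  · simp only [Matrix.cons_val_zero, Matrix.cons_val_one, Fin.mk_one]
    field_simp

include hφ in
/-- `φ⁻¹` maps the open simplex into the open box. -/
theorem stickBreakingInv_mem_box_two {ρ : Fin 2 → ℝ} (hρ : 0 < ρ 0 ∧ 0 < ρ 1 ∧ ρ 0 + ρ 1 < 1) :
    (![ρ 0, ρ 1 / (1 - ρ 0)] : Fin 2 → ℝ) ∈ Set.pi univ fun _ : Fin 2 => Ioo (0 : ℝ) 1 := by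
  have hmem : ρ ∈ (fun a : Fin 2 → ℝ => (![a 0, a 1 * (1 - a 0)] : Fin 2 → ℝ)) ''
      (Set.pi univ fun _ : Fin 2 => Ioo (0 : ℝ) 1) := by
    rw [image_stickBreaking_two]
    exact hρ
  obtain ⟨a, ha, rfl⟩ := hmem
  have ha0 := (Set.mem_univ_pi.mp ha) 0
  have h := stickBreaking_leftInverse_two hφ (a := a) ha0.2.ne
  simp only [hφ] at h
  rw [h]
  exact ha

include hζ in
/-- `ζ⁻¹` maps the alcove into the open simplex. -/
theorem alcoveAffineInv_mem_simplex_su3 {θ : Fin 2 → ℝ} (hθ : θ 0 < θ 1 ∧ θ 1 < -(θ 0 + θ 1) ∧ -(θ 0 + θ 1) < θ 0 + 2 * π) :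
    (![-(θ 0 + 2 * θ 1) / (2 * π), (2 * θ 0 + θ 1) / (2 * π) + 1] : Fin 2 → ℝ) ∈
      {ρ : Fin 2 → ℝ | 0 < ρ 0 ∧ 0 < ρ 1 ∧ ρ 0 + ρ 1 < 1} := by
  have hmem : θ ∈ (fun r : Fin 2 → ℝ =>
      (![-(4 * π / 3) + 2 * π / 3 * r 0 + 4 * π / 3 * r 1, 2 * π / 3 - 4 * π / 3 * r 0 - 2 * π / 3 * r 1] :
        Fin 2 → ℝ)) '' {ρ : Fin 2 → ℝ | 0 < ρ 0 ∧ 0 < ρ 1 ∧ ρ 0 + ρ 1 < 1} := by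
    rw [image_alcoveAffine_su3]
    exact hθ
  obtain ⟨r, hr, rfl⟩ := hmem
  have h := alcoveAffine_leftInverse_su3 hζ r
  simp only [hζ] at h
  rw [h]
  exact hr

include hφ hζ in
/-- `ζ ∘ φ` maps the open box into the alcove. -/
theorem alcoveAffine_stickBreaking_mem_alcove_su3 {a : Fin 2 → ℝ} (ha : a ∈ Set.pi univ fun _ : Fin 2 => Ioo (0 : ℝ) 1) :
    (ζ (φ a)) 0 < (ζ (φ a)) 1 ∧ (ζ (φ a)) 1 < -((ζ (φ a)) 0 + (ζ (φ a)) 1) ∧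
      -((ζ (φ a)) 0 + (ζ (φ a)) 1) < (ζ (φ a)) 0 + 2 * π := by
  have hρ : φ a ∈ {ρ : Fin 2 → ℝ | 0 < ρ 0 ∧ 0 < ρ 1 ∧ ρ 0 + ρ 1 < 1} := by
    rw [← image_stickBreaking_two, hφ]
    exact ⟨a, ha, rfl⟩
  have hθ : ζ (φ a) ∈ {θ : Fin 2 → ℝ | θ 0 < θ 1 ∧ θ 1 < -(θ 0 + θ 1) ∧ -(θ 0 + θ 1) < θ 0 + 2 * π} := by
    rw [← image_alcoveAffine_su3, hζ]
    exact ⟨φ a, hρ, rfl⟩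
  exact hθ

end Charts

/-! ## The kernel in box coordinates -/

section Booked

variable {E : (Fin 2 → ℝ) → specialDiagonalTorus (Fin 3)}
  (hE : ∀ θ (i : Fin 3), (((E θ : specialDiagonalTorus (Fin 3)) : Matrix.specialUnitaryGroup (Fin 3) ℂ) :
    Matrix (Fin 3) (Fin 3) ℂ) i i = (Circle.exp ((![θ 0, θ 1, -(θ 0 + θ 1)] : Fin 3 → ℝ) i) : ℂ))
  {P : Equiv.Perm (Fin 3) → specialDiagonalTorus (Fin 3) → specialDiagonalTorus (Fin 3)}
  (hP : ∀ σ t i,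
    (((P σ t : specialDiagonalTorus (Fin 3)) : Matrix.specialUnitaryGroup (Fin 3) ℂ) : Matrix (Fin 3) (Fin 3) ℂ) i i =
      ((t : Matrix.specialUnitaryGroup (Fin 3) ℂ) : Matrix (Fin 3) (Fin 3) ℂ) (σ i) (σ i))
  {φ ζ : (Fin 2 → ℝ) → (Fin 2 → ℝ)}
  (hφ : ∀ a, φ a = ![a 0, a 1 * (1 - a 0)])
  (hζ : ∀ r, ζ r = ![-(4 * π / 3) + 2 * π / 3 * r 0 + 4 * π / 3 * r 1, 2 * π / 3 - 4 * π / 3 * r 0 - 2 * π / 3 * r 1])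

include hE hP hφ hζ

/-- **The `SU(3)` spectral kernel in the engine's box coordinate is an exact transport of Haar with
exactly the booked density.**  `χ` a box flow on `B = (0,1)²` with `HasJacobian (Leb|_B) χ Jχ` mapping
`B` into itself; `f` measurable (no continuity), permutation-equivariant, with
`f(e^{i x(ζφa)}) = e^{i x(ζφ(χa))}` for `a ∈ B` (the cell flow read through the stick-breaking and
affine charts), preserving unimodularity and unit product; `h` ANY kernel following the spectral recipe of `f`; `J` ANY
measurable density which is a symmetric measurable function `JD` of the spectrum whose value on the
alcove chart is the booked one: for `a ∈ B`,
`JD(e^{ix(ζφa)}) · |Δ(e^{ix(ζφa)})|²/3! = (|1 − (χa)₀| · Jχ(a) / |1 − a₀|) · |Δ(e^{ix(ζφ(χa))})|²/3!`.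
Then `HasJacobian (Haar SU(3)) h J`. -/
theorem hasJacobian_spectralKernel_su3_booked_boxFlow
    {f : (Fin 3 → ℂ) → (Fin 3 → ℂ)} (hfm : Measurable f)
    (hfperm : ∀ (σ : Equiv.Perm (Fin 3)) (d : Fin 3 → ℂ), (∀ i, ‖d i‖ = 1) →
      f (fun i => d (σ i)) = fun i => f d (σ i))
    {χ : (Fin 2 → ℝ) → (Fin 2 → ℝ)} {Jχ : (Fin 2 → ℝ) → ℝ≥0∞}
    (hχ : HasJacobian (volume.restrict (Set.pi univ fun _ : Fin 2 => Ioo (0 : ℝ) 1)) χ Jχ)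
    (hχbox : ∀ a ∈ Set.pi univ (fun _ : Fin 2 => Ioo (0 : ℝ) 1), χ a ∈ Set.pi univ fun _ : Fin 2 => Ioo (0 : ℝ) 1)
    (hfG : ∀ a ∈ Set.pi univ (fun _ : Fin 2 => Ioo (0 : ℝ) 1),
      f (fun i => (Circle.exp ((![(ζ (φ a)) 0, (ζ (φ a)) 1, -((ζ (φ a)) 0 + (ζ (φ a)) 1)] : Fin 3 → ℝ) i) : ℂ)) =
        fun i => (Circle.exp ((![(ζ (φ (χ a))) 0, (ζ (φ (χ a))) 1,
          -((ζ (φ (χ a))) 0 + (ζ (φ (χ a))) 1)] : Fin 3 → ℝ) i) : ℂ))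
    {h : Matrix.specialUnitaryGroup (Fin 3) ℂ → Matrix.specialUnitaryGroup (Fin 3) ℂ}
    (hagree : ∀ (Q : Matrix.specialUnitaryGroup (Fin 3) ℂ) (V : Matrix (Fin 3) (Fin 3) ℂ) (d : Fin 3 → ℂ),
      V ∈ Matrix.unitaryGroup (Fin 3) ℂ → (Q : Matrix (Fin 3) (Fin 3) ℂ) = V * diagonal d * star V →
        ((h Q : Matrix.specialUnitaryGroup (Fin 3) ℂ) : Matrix (Fin 3) (Fin 3) ℂ) = V * diagonal (f d) * star V)
    (hf1 : ∀ d : Fin 3 → ℂ, (∀ i, ‖d i‖ = 1) → ∀ i, ‖f d i‖ = 1)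
    (hfdet : ∀ d : Fin 3 → ℂ, (∀ i, ‖d i‖ = 1) → ∏ i, d i = 1 → ∏ i, f d i = 1)
    {JD : (Fin 3 → ℂ) → ℝ≥0∞} (hJDm : Measurable JD)
    (hJDperm : ∀ (σ : Equiv.Perm (Fin 3)) (d : Fin 3 → ℂ), JD (fun i => d (σ i)) = JD d)
    (hJchart : ∀ a ∈ Set.pi univ (fun _ : Fin 2 => Ioo (0 : ℝ) 1),
      JD (fun i => (Circle.exp ((![(ζ (φ a)) 0, (ζ (φ a)) 1, -((ζ (φ a)) 0 + (ζ (φ a)) 1)] : Fin 3 → ℝ) i) : ℂ)) *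
          ENNReal.ofReal ((∏ i, ∏ k ∈ Finset.univ.erase i,
            ‖(Circle.exp ((![(ζ (φ a)) 0, (ζ (φ a)) 1, -((ζ (φ a)) 0 + (ζ (φ a)) 1)] : Fin 3 → ℝ) i) : ℂ) -
              (Circle.exp ((![(ζ (φ a)) 0, (ζ (φ a)) 1, -((ζ (φ a)) 0 + (ζ (φ a)) 1)] : Fin 3 → ℝ) k) : ℂ)‖) /
                (Fintype.card (Fin 3)).factorial) =
        (ENNReal.ofReal |1 - (χ a) 0| * Jχ a / ENNReal.ofReal |1 - a 0|) *
          ENNReal.ofReal ((∏ i, ∏ k ∈ Finset.univ.erase i,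
            ‖(Circle.exp ((![(ζ (φ (χ a))) 0, (ζ (φ (χ a))) 1, -((ζ (φ (χ a))) 0 + (ζ (φ (χ a))) 1)] : Fin 3 → ℝ) i) : ℂ) -
              (Circle.exp ((![(ζ (φ (χ a))) 0, (ζ (φ (χ a))) 1, -((ζ (φ (χ a))) 0 + (ζ (φ (χ a))) 1)] :
                Fin 3 → ℝ) k) : ℂ)‖) / (Fintype.card (Fin 3)).factorial))
    {J : Matrix.specialUnitaryGroup (Fin 3) ℂ → ℝ≥0∞}
    (hJspec : ∀ (W : Matrix.specialUnitaryGroup (Fin 3) ℂ) (V : Matrix (Fin 3) (Fin 3) ℂ) (d : Fin 3 → ℂ),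
      V ∈ Matrix.unitaryGroup (Fin 3) ℂ → (W : Matrix (Fin 3) (Fin 3) ℂ) = V * diagonal d * star V → J W = JD d) :
    HasJacobian (haarProbability (Matrix.specialUnitaryGroup (Fin 3) ℂ)) h J := by
  -- the inverse charts
  set φi : (Fin 2 → ℝ) → (Fin 2 → ℝ) := fun ρ => ![ρ 0, ρ 1 / (1 - ρ 0)] with hφi
  set ζi : (Fin 2 → ℝ) → (Fin 2 → ℝ) := fun θ => ![-(θ 0 + 2 * θ 1) / (2 * π), (2 * θ 0 + θ 1) / (2 * π) + 1] with hζi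
  -- measurability of the charts
  have hm0 : Measurable fun a : Fin 2 → ℝ => a 0 := measurable_pi_apply 0
  have hm1 : Measurable fun a : Fin 2 → ℝ => a 1 := measurable_pi_apply 1
  have hφ1 : Measurable fun a : Fin 2 → ℝ => a 1 * (1 - a 0) := hm1.mul (measurable_const.sub hm0)
  have hζ0 : Measurable fun r : Fin 2 → ℝ => -(4 * π / 3) + 2 * π / 3 * r 0 + 4 * π / 3 * r 1 :=
    (measurable_const.add (measurable_const.mul hm0)).add (measurable_const.mul hm1)
  have hζ1 : Measurable fun r : Fin 2 → ℝ => 2 * π / 3 - 4 * π / 3 * r 0 - 2 * π / 3 * r 1 :=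
    (measurable_const.sub (measurable_const.mul hm0)).sub (measurable_const.mul hm1)
  have hφi1 : Measurable fun ρ : Fin 2 → ℝ => ρ 1 / (1 - ρ 0) := hm1.div (measurable_const.sub hm0)
  have hζi0 : Measurable fun θ : Fin 2 → ℝ => -(θ 0 + 2 * θ 1) / (2 * π) :=
    (hm0.add (measurable_const.mul hm1)).neg.div measurable_const
  have hζi1 : Measurable fun θ : Fin 2 → ℝ => (2 * θ 0 + θ 1) / (2 * π) + 1 :=
    (((measurable_const.mul hm0).add hm1).div measurable_const).add measurable_const
  have hφm : Measurable φ := by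
    rw [show φ = fun a => (![a 0, a 1 * (1 - a 0)] : Fin 2 → ℝ) from funext hφ]
    exact measurable_pi_lambda _ fun i => by
      fin_cases i
      · simpa using hm0
      · simpa using hφ1
  have hζm : Measurable ζ := by
    rw [show ζ = fun r => (![-(4 * π / 3) + 2 * π / 3 * r 0 + 4 * π / 3 * r 1,
      2 * π / 3 - 4 * π / 3 * r 0 - 2 * π / 3 * r 1] : Fin 2 → ℝ) from funext hζ]
    exact measurable_pi_lambda _ fun i => by
      fin_cases i
      · simpa using hζ0
      · simpa using hζ1
  have hφim : Measurable φi := measurable_pi_lambda _ fun i => by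
    fin_cases i
    · simpa [hφi] using hm0
    · simpa [hφi] using hφi1
  have hζim : Measurable ζi := measurable_pi_lambda _ fun i => by
    fin_cases i
    · simpa [hζi] using hζi0
    · simpa [hζi] using hζi1
  have hχm : Measurable χ := hχ.measurable
  have hJχm : Measurable Jχ := hχ.measurable_jac
  -- the alcove flow and its Jacobian
  set G : (Fin 2 → ℝ) → (Fin 2 → ℝ) := fun θ => ζ (φ (χ (φi (ζi θ)))) with hG
  set JA : (Fin 2 → ℝ) → ℝ≥0∞ := fun θ =>
    ENNReal.ofReal |1 - (χ (φi (ζi θ))) 0| * Jχ (φi (ζi θ)) / ENNReal.ofReal |1 - (φi (ζi θ)) 0| with hJA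
  have hGm : Measurable G := hζm.comp (hφm.comp (hχm.comp (hφim.comp hζim)))
  have hdens : Measurable fun a : Fin 2 → ℝ => ENNReal.ofReal |1 - (χ a) 0| * Jχ a / ENNReal.ofReal |1 - a 0| :=
    ((ENNReal.measurable_ofReal.comp ((measurable_const.sub (hm0.comp hχm)).abs)).mul hJχm).div
      (ENNReal.measurable_ofReal.comp ((measurable_const.sub hm0).abs))
  have hJAm : Measurable JA := hdens.comp (hφim.comp hζim)
  -- the points of the alcove in box coordinates
  have hbox : ∀ θ : Fin 2 → ℝ, θ 0 < θ 1 → θ 1 < -(θ 0 + θ 1) → -(θ 0 + θ 1) < θ 0 + 2 * π →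
      φi (ζi θ) ∈ Set.pi univ (fun _ : Fin 2 => Ioo (0 : ℝ) 1) ∧ ζ (φ (φi (ζi θ))) = θ := by
    intro θ h0 h1 h2
    have hρ : ζi θ ∈ {ρ : Fin 2 → ℝ | 0 < ρ 0 ∧ 0 < ρ 1 ∧ ρ 0 + ρ 1 < 1} :=
      alcoveAffineInv_mem_simplex_su3 hζ ⟨h0, h1, h2⟩
    refine ⟨stickBreakingInv_mem_box_two hφ hρ, ?_⟩
    have hρ0 : (ζi θ) 0 ≠ 1 := by
      have h := hρ
      simp only [Set.mem_setOf_eq] at h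
      linarith [h.1, h.2.1, h.2.2]
    show ζ (φ (![(ζi θ) 0, (ζi θ) 1 / (1 - (ζi θ) 0)])) = θ
    rw [stickBreaking_rightInverse_two hφ hρ0]
    exact alcoveAffine_rightInverse_su3 hζ θ
  -- `HasJacobian (Leb|_A) G JA` from the box flow through the two charts
  have hGJ : HasJacobian ((volume : Measure (Fin 2 → ℝ)).restrict
      {θ : Fin 2 → ℝ | θ 0 < θ 1 ∧ θ 1 < -(θ 0 + θ 1) ∧ -(θ 0 + θ 1) < θ 0 + 2 * π}) G JA := by
    refine hasJacobian_alcove_of_boxFlow_su3 hχ (G' := fun ρ => φ (χ (φi ρ)))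
      (hφm.comp (hχm.comp hφim)) (J' := fun ρ => ENNReal.ofReal |1 - (χ (φi ρ)) 0| * Jχ (φi ρ) /
        ENNReal.ofReal |1 - (φi ρ) 0|) (hdens.comp hφim) ?_ ?_ hGm hJAm ?_ ?_
    · refine (ae_restrict_iff' measurableSet_openBox_two).mpr (Filter.Eventually.of_forall fun a ha => ?_)
      have ha0 := (Set.mem_univ_pi.mp ha) 0
      have hinv : φi (φ a) = a := stickBreaking_leftInverse_two hφ ha0.2.ne
      simp only [← hφ]
      show φ (χ (φi (φ a))) = φ (χ a)
      rw [hinv]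
    · refine (ae_restrict_iff' measurableSet_openBox_two).mpr (Filter.Eventually.of_forall fun a ha => ?_)
      have ha0 := (Set.mem_univ_pi.mp ha) 0
      have hinv : φi (φ a) = a := stickBreaking_leftInverse_two hφ ha0.2.ne
      simp only [← hφ]
      show ENNReal.ofReal |1 - (χ (φi (φ a))) 0| * Jχ (φi (φ a)) / ENNReal.ofReal |1 - (φi (φ a)) 0| = _
      rw [hinv]
    · refine Filter.Eventually.of_forall fun ρ => ?_
      have hinv : ζi (ζ ρ) = ρ := alcoveAffine_leftInverse_su3 hζ ρ
      simp only [← hζ]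
      show ζ (φ (χ (φi (ζi (ζ ρ))))) = ζ (φ (χ (φi ρ)))
      rw [hinv]
    · refine Filter.Eventually.of_forall fun ρ => ?_
      have hinv : ζi (ζ ρ) = ρ := alcoveAffine_leftInverse_su3 hζ ρ
      simp only [← hζ]
      show ENNReal.ofReal |1 - (χ (φi (ζi (ζ ρ)))) 0| * Jχ (φi (ζi (ζ ρ))) / ENNReal.ofReal |1 - (φi (ζi (ζ ρ))) 0| = _
      rw [hinv]
  -- the hypotheses of the booked kernel theorem, read at `θ = ζ(φ a)`
  have hGA : ∀ θ : Fin 2 → ℝ, θ 0 < θ 1 → θ 1 < -(θ 0 + θ 1) → -(θ 0 + θ 1) < θ 0 + 2 * π →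
      (G θ) 0 < (G θ) 1 ∧ (G θ) 1 < -((G θ) 0 + (G θ) 1) ∧ -((G θ) 0 + (G θ) 1) < (G θ) 0 + 2 * π := by
    intro θ h0 h1 h2
    exact alcoveAffine_stickBreaking_mem_alcove_su3 hφ hζ (hχbox _ (hbox θ h0 h1 h2).1)
  have hfG' : ∀ θ : Fin 2 → ℝ, θ 0 < θ 1 → θ 1 < -(θ 0 + θ 1) → -(θ 0 + θ 1) < θ 0 + 2 * π →
      f (fun i => (Circle.exp ((![θ 0, θ 1, -(θ 0 + θ 1)] : Fin 3 → ℝ) i) : ℂ)) =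
        fun i => (Circle.exp ((![(G θ) 0, (G θ) 1, -((G θ) 0 + (G θ) 1)] : Fin 3 → ℝ) i) : ℂ) := by
    intro θ h0 h1 h2
    obtain ⟨ha, hθ⟩ := hbox θ h0 h1 h2
    have h := hfG _ ha
    rw [hθ] at h
    exact h
  have hJchart' : ∀ θ : Fin 2 → ℝ, θ 0 < θ 1 → θ 1 < -(θ 0 + θ 1) → -(θ 0 + θ 1) < θ 0 + 2 * π →
      JD (fun i => (Circle.exp ((![θ 0, θ 1, -(θ 0 + θ 1)] : Fin 3 → ℝ) i) : ℂ)) * ENNReal.ofReal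
          ((∏ i, ∏ k ∈ Finset.univ.erase i,
            ‖(Circle.exp ((![θ 0, θ 1, -(θ 0 + θ 1)] : Fin 3 → ℝ) i) : ℂ) -
              (Circle.exp ((![θ 0, θ 1, -(θ 0 + θ 1)] : Fin 3 → ℝ) k) : ℂ)‖) / (Fintype.card (Fin 3)).factorial) =
        JA θ * ENNReal.ofReal
          ((∏ i, ∏ k ∈ Finset.univ.erase i,
            ‖(Circle.exp ((![(G θ) 0, (G θ) 1, -((G θ) 0 + (G θ) 1)] : Fin 3 → ℝ) i) : ℂ) -
              (Circle.exp ((![(G θ) 0, (G θ) 1, -((G θ) 0 + (G θ) 1)] : Fin 3 → ℝ) k) : ℂ)‖) /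
                (Fintype.card (Fin 3)).factorial) := by
    intro θ h0 h1 h2
    obtain ⟨ha, hθ⟩ := hbox θ h0 h1 h2
    have h := hJchart _ ha
    rw [hθ] at h
    exact h
  exact hasJacobian_spectralKernel_su3_booked hE hP hfm hfperm hGJ hGA hfG' hagree hf1 hfdet hJDm hJDperm hJchart' hJspec

end Booked

end Summit.Ventures.LatticeQCDFlow.Exactness
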